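import Literature.NumberTheory.IwasawaTheory.IwasawaModuleMuZeroOfRankJump
import Literature.NumberTheory.EllipticCurves.IwasawaAlgebraInvolutionEvenLambdaProofs
import Literature.NumberTheory.EllipticCurves.IwasawaAlgebraEisensteinQuotientTorsionProofs
import Literature.NumberTheory.EllipticCurves.IwasawaAlgebraProofs
import HarnessLib

/-!
# The rank-jump criterion, sequel: `p^{λ(M)} ≤ #(M/(T^b,p)M)`, the LAYER form `#(M/(ω_k,p)M) · p^{p^j} < #(M/(ω_j,p)M) · p^{p^k}`
# (`ω_n = (1+T)^{pⁿ} − 1`), and the converse «`μ = 0` ⟺ the door opens at some pair»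

`Proofs`-style file (theorems only: no definition, no named fact, no `sorry`) in topic `NumberTheory/IwasawaTheory`
(namespace `Literature.NumberTheory.IwasawaTheory.IwasawaModuleRankJump`), written by the prover seat `bsd-line-att-p5` g43
(cell `bsd-f1-sign2`, route `AlignedTransportAtTwo`; `--supports` stmt-BirchSwinnertonDyer-22298, closes nothing; BSD is not
proved by any of this). Sequel of `IwasawaModuleMuZeroOfRankJump` (the mechanism: a rank jump `#Q_b · p^a < #Q_a · p^b`,
`Q_i = M/(T^i, p)M`, at ONE pair `a < b` forces `M/pM` finite, `μ(M) = 0`).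

* §5 `pow_finrank_le_natCard_quotient_maximalIdeal` (any finitely generated `ℤ_p`-module `N` with `N/pN` finite:
  `p^{rank_{ℤ_p} N} ≤ #(N/pN)`, Nakayama); ★ `pow_lambdaInvariant_le_natCard_quotient_augIdealP` — **`p^{λ(M)} ≤ #(M/pM)`** for a
  finitely generated `Λ`-module with `M/pM` finite; ★ `pow_lambdaInvariant_le_of_card_lt` — **`p^{λ(M)} ≤ #Q_b`** under the jump.
* §6 the LAYER form (`(ω_n, p) = (T^{pⁿ}, p)`): ★★ `muInvariant_eq_zero_of_card_layerQuotient_lt` — **`#Q'_k · p^{p^j} < #Q'_j · p^{p^k}`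
  for one pair `j < k`, `Q'_n = M/(ω_n, p)M`, forces `μ(M) = 0`**; `isTorsion_…`, `moduleFinite_padicInt_…`,
  `finite_quotient_augIdealP_and_natCard_eq_…`, ★ `pow_lambdaInvariant_le_of_card_layerQuotient_lt` (`p^λ ≤ #Q'_k`). For the
  Pontryagin dual `X` of `Sel_{p^∞}(E/K_∞)` one has `#Q'_n = #Sel_∞^{Γ_n}[p]` (Summits-side consumer: the Selmer rank-jump `μ`-door).
* §7 CONVERSE: `exists_forall_smul_top_eq_of_finite_quotient_augIdealP` (`M/pM` finite ⟹ `J_aM = pM` for `a ≫ 0`),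
  `exists_card_lt_of_finite_quotient_augIdealP`, `finite_quotient_augIdealP_of_muInvariant_eq_zero` (`μ = 0`, torsion ⟹ `M/pM`
  finite), ★ `muInvariant_eq_zero_iff_exists_card_lt` — **for a finitely generated torsion `Λ`-module, `μ(M) = 0` iff the rank-jump
  door opens at SOME pair `a < b`** (the door is complete).

References: [Washington1997] GTM 83, §13.2 (Nakayama; structure of `Λ`-modules, `λ = rank_{ℤ_p}`), §13.3 Lemma 13.18, Prop.
13.22–13.23; [Fukuda1994] Proc. Japan Acad. 70 A (1994), Thm. 1; [GreenbergLNM1716] LNM 1716, §1 pp. 60–61.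
-/

set_option autoImplicit false

noncomputable section

open scoped Classical TensorProduct

universe u

namespace Literature.NumberTheory.IwasawaTheory.IwasawaModuleRankJump

open PowerSeries Literature.NumberTheory.EllipticCurves Literature.NumberTheory.EllipticCurves.IwasawaAlgebra
  Literature.NumberTheory.EllipticCurves.IwasawaModuleFinitePadicInt

variable {p : ℕ} [hp : Fact p.Prime]

/-! ## §5 `p^{λ(M)} ≤ #(M/pM)` (Nakayama over `ℤ_p`) and the `λ`-bound under the rank jump -/

section Lambda

/-- **`p^{rank_{ℤ_p} N} ≤ #(N/pN)`** for a finitely generated `ℤ_p`-module `N` with `N/pN` finite: lifts of an `𝔽_p`-basis of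
`N/pN` generate `N` (Nakayama), so `ℚ_p ⊗ N` is spanned by `dim_{𝔽_p} N/pN` vectors. [cite: Washington1997, §13.2 (Nakayama's lemma)] -/
theorem pow_finrank_le_natCard_quotient_maximalIdeal {N : Type u} [AddCommGroup N] [Module ℤ_[p] N] [Module.Finite ℤ_[p] N]
    [Finite (N ⧸ (IsLocalRing.maximalIdeal ℤ_[p]) • (⊤ : Submodule ℤ_[p] N))] :
    p ^ Module.finrank ℚ_[p] (ℚ_[p] ⊗[ℤ_[p]] N) ≤
      Nat.card (N ⧸ (IsLocalRing.maximalIdeal ℤ_[p]) • (⊤ : Submodule ℤ_[p] N)) := by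
  letI : Module (IsLocalRing.ResidueField ℤ_[p]) (N ⧸ (IsLocalRing.maximalIdeal ℤ_[p]) • (⊤ : Submodule ℤ_[p] N)) :=
    inferInstanceAs (Module (ℤ_[p] ⧸ IsLocalRing.maximalIdeal ℤ_[p])
      (N ⧸ (IsLocalRing.maximalIdeal ℤ_[p]) • (⊤ : Submodule ℤ_[p] N)))
  haveI : IsScalarTower ℤ_[p] (IsLocalRing.ResidueField ℤ_[p])
      (N ⧸ (IsLocalRing.maximalIdeal ℤ_[p]) • (⊤ : Submodule ℤ_[p] N)) :=
    inferInstanceAs (IsScalarTower ℤ_[p] (ℤ_[p] ⧸ IsLocalRing.maximalIdeal ℤ_[p])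
      (N ⧸ (IsLocalRing.maximalIdeal ℤ_[p]) • (⊤ : Submodule ℤ_[p] N)))
  haveI : Module.Finite (IsLocalRing.ResidueField ℤ_[p]) (N ⧸ (IsLocalRing.maximalIdeal ℤ_[p]) • (⊤ : Submodule ℤ_[p] N)) :=
    Module.Finite.of_finite
  have hk : Nat.card (IsLocalRing.ResidueField ℤ_[p]) = p := by
    rw [Nat.card_congr (PadicInt.residueField (p := p)).toEquiv, Nat.card_zmod]
  have hcard : Nat.card (N ⧸ (IsLocalRing.maximalIdeal ℤ_[p]) • (⊤ : Submodule ℤ_[p] N)) =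
      p ^ Module.finrank (IsLocalRing.ResidueField ℤ_[p]) (N ⧸ (IsLocalRing.maximalIdeal ℤ_[p]) • (⊤ : Submodule ℤ_[p] N)) := by
    rw [Module.natCard_eq_pow_finrank (K := IsLocalRing.ResidueField ℤ_[p]), hk]
  -- an `𝔽_p`-basis of `N/pN` and lifts of it
  let bs := Module.finBasis (IsLocalRing.ResidueField ℤ_[p]) (N ⧸ (IsLocalRing.maximalIdeal ℤ_[p]) • (⊤ : Submodule ℤ_[p] N))
  choose f hf using fun i ↦ Submodule.mkQ_surjective ((IsLocalRing.maximalIdeal ℤ_[p]) • (⊤ : Submodule ℤ_[p] N)) (bs i)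
  have hspan : Submodule.span ℤ_[p] (Set.range f) = ⊤ := by
    rw [← IsLocalRing.map_mkQ_eq_top, Submodule.map_span, ← Set.range_comp]
    have hcomp : (((IsLocalRing.maximalIdeal ℤ_[p]) • (⊤ : Submodule ℤ_[p] N)).mkQ ∘ f) = bs := funext hf
    rw [hcomp, ← Submodule.restrictScalars_span ℤ_[p] (IsLocalRing.ResidueField ℤ_[p]) Ideal.Quotient.mk_surjective,
      bs.span_eq, Submodule.restrictScalars_top]
  -- `ℚ_p ⊗ N` is spanned by the `1 ⊗ f i`
  have htop : Submodule.span ℚ_[p] (Set.range ((TensorProduct.mk ℤ_[p] ℚ_[p] N 1) ∘ f)) = ⊤ := by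
    rw [Set.range_comp, ← Submodule.baseChange_span, hspan, Submodule.baseChange_top]
  rw [hcard]
  apply Nat.pow_le_pow_right hp.out.pos
  rw [← finrank_top ℚ_[p], ← htop]
  exact (finrank_range_le_card _).trans (Fintype.card_fin _).le

variable {M : Type u} [AddCommGroup M] [Module (IwasawaAlgebra p) M] [Module.Finite (IwasawaAlgebra p) M]

/-- **`p^{λ(M)} ≤ #(M/pM)`** for a finitely generated `Λ`-module with `M/pM` finite: `M` is finitely generated over `ℤ_p` (tree),
lifts `s_1, …, s_d` of an `𝔽_p`-basis of `M/pM` generate `M` over `ℤ_p` (Nakayama: `M ⊆ ∑ ℤ_p s_i + pM`), so `ℚ_p ⊗_{ℤ_p} M` is spanned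
by `d = dim_{𝔽_p} M/pM` vectors and `λ(M) = dim_{ℚ_p}(ℚ_p ⊗ M) ≤ d`. [cite: Washington1997, §13.2 (after Thm 13.12; Nakayama's lemma)]
[cite: GreenbergLNM1716, §1 p. 60] -/
theorem pow_lambdaInvariant_le_natCard_quotient_augIdealP
    (hfin : Finite (M ⧸ augIdealP p • (⊤ : Submodule (IwasawaAlgebra p) M))) :
    p ^ lambdaInvariant p M ≤ Nat.card (M ⧸ augIdealP p • (⊤ : Submodule (IwasawaAlgebra p) M)) := by
  haveI := hfin
  -- the `ℤ_p`-structure of `M` (the one of `RestrictScalars ℤ_p Λ M`, put on `M` itself)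
  letI : Module ℤ_[p] M := Module.compHom M (algebraMap ℤ_[p] (IwasawaAlgebra p))
  haveI : IsScalarTower ℤ_[p] (IwasawaAlgebra p) M := IsScalarTower.of_algebraMap_smul fun _ _ ↦ rfl
  haveI hfg : Module.Finite ℤ_[p] M := moduleFinite_padicInt_of_finite_quotient_augIdealP p M hfin
  set P : Submodule (IwasawaAlgebra p) M := augIdealP p • ⊤ with hPdef
  -- `M/pM` as an `𝔽_p`-space
  have hpV : ∀ v : M ⧸ P, p • v = 0 := by
    intro v
    induction v using Submodule.Quotient.induction_on with
    | H m =>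
      rw [← Nat.cast_smul_eq_nsmul (IwasawaAlgebra p), ← Submodule.Quotient.mk_smul, Submodule.Quotient.mk_eq_zero,
        ← map_natCast (C (R := ℤ_[p]))]
      exact Submodule.smul_mem_smul (Ideal.mem_span_singleton_self _) Submodule.mem_top
  haveI : Module (ZMod p) (M ⧸ P) := AddCommGroup.zmodModule hpV
  haveI : Module.Finite (ZMod p) (M ⧸ P) := Module.Finite.of_finite
  have hcard : Nat.card (M ⧸ P) = p ^ Module.finrank (ZMod p) (M ⧸ P) := by
    rw [Module.natCard_eq_pow_finrank (K := ZMod p), Nat.card_zmod]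
  -- an `𝔽_p`-basis of `M/pM` and lifts of it
  let bs := Module.finBasis (ZMod p) (M ⧸ P)
  choose f hf using fun i ↦ Submodule.mkQ_surjective P (bs i)
  have hsmul : ∀ m : M, (p : ℤ_[p]) • m = (C (p : ℤ_[p]) : IwasawaAlgebra p) • m := by
    intro m
    change (algebraMap ℤ_[p] (IwasawaAlgebra p) (p : ℤ_[p])) • m = _
    rw [PowerSeries.algebraMap_apply, Algebra.algebraMap_self_apply]
  have hpmem : (p : ℤ_[p]) ∈ IsLocalRing.maximalIdeal ℤ_[p] := PadicInt.p_nonunit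
  -- Nakayama over `ℤ_p`: the lifts generate `M` over `ℤ_p`
  have hspan : Submodule.span ℤ_[p] (Set.range f) = ⊤ := by
    refine top_le_iff.mp (Submodule.le_of_le_smul_of_le_jacobson_bot Module.Finite.fg_top
      (le_of_eq (IsLocalRing.jacobson_eq_maximalIdeal (⊥ : Ideal ℤ_[p]) bot_ne_top).symm) ?_)
    intro x _
    -- `x ≡ ∑ cᵢ • fᵢ (mod pM)`, `cᵢ ∈ ℕ` lifting the coordinates of `x mod pM`
    have hx : P.mkQ x = P.mkQ (∑ i, (bs.repr (P.mkQ x) i).val • f i) := by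
      rw [map_sum]
      conv_lhs => rw [← bs.sum_repr (P.mkQ x)]
      refine Finset.sum_congr rfl fun i _ ↦ ?_
      rw [map_nsmul, hf i, ← Nat.cast_smul_eq_nsmul (ZMod p), ZMod.natCast_zmod_val]
    rw [Submodule.mkQ_apply, Submodule.mkQ_apply, eq_comm, Submodule.Quotient.eq] at hx
    change (∑ i, (bs.repr (P.mkQ x) i).val • f i) - x ∈
      Ideal.span {(C (p : ℤ_[p]) : IwasawaAlgebra p)} • (⊤ : Submodule (IwasawaAlgebra p) M) at hx
    rw [Submodule.ideal_span_singleton_smul, Submodule.mem_smul_pointwise_iff_exists] at hx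
    obtain ⟨m, -, hm⟩ := hx
    -- so `x = ∑ cᵢ fᵢ - p • m`
    have hxeq : x = (∑ i, (bs.repr (P.mkQ x) i).val • f i) - (p : ℤ_[p]) • m := by
      rw [hsmul, hm]
      exact (sub_sub_cancel _ _).symm
    rw [hxeq]
    refine Submodule.sub_mem _ (Submodule.sum_mem _ fun i _ ↦ ?_) ?_
    · exact Submodule.mem_sup_left (nsmul_mem (Submodule.subset_span (Set.mem_range_self i)) _)
    · exact Submodule.mem_sup_right (Submodule.smul_mem_smul hpmem Submodule.mem_top)
  -- `ℚ_p ⊗ M` is spanned by the `1 ⊗ f i`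
  have htop : Submodule.span ℚ_[p] (Set.range ((TensorProduct.mk ℤ_[p] ℚ_[p] M 1) ∘ f)) = ⊤ := by
    rw [Set.range_comp, ← Submodule.baseChange_span, hspan, Submodule.baseChange_top]
  rw [hcard, lambdaInvariant_eq_finrank_tensorProduct]
  apply Nat.pow_le_pow_right hp.out.pos
  rw [← finrank_top ℚ_[p], ← htop]
  exact (finrank_range_le_card _).trans (Fintype.card_fin _).le

/-- **`p^{λ(M)} ≤ #Q_b`** under the rank jump at `a < b` (`λ(M) ≤ dim_{𝔽_p} M/(T^b, p)M`).
[cite: Washington1997, §13.3 Prop. 13.23] [cite: Fukuda1994, Thm. 1 (2)] -/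
theorem pow_lambdaInvariant_le_of_card_lt {a b : ℕ} (hab : a < b)
    (hlt : Nat.card (M ⧸ (Ideal.span {(X : IwasawaAlgebra p) ^ b} ⊔ augIdealP p) • (⊤ : Submodule (IwasawaAlgebra p) M)) *
        p ^ a <
      Nat.card (M ⧸ (Ideal.span {(X : IwasawaAlgebra p) ^ a} ⊔ augIdealP p) • (⊤ : Submodule (IwasawaAlgebra p) M)) *
        p ^ b) :
    p ^ lambdaInvariant p M ≤
      Nat.card (M ⧸ (Ideal.span {(X : IwasawaAlgebra p) ^ b} ⊔ augIdealP p) • (⊤ : Submodule (IwasawaAlgebra p) M)) := by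
  rw [← natCard_quotient_augIdealP_eq_of_card_lt hab hlt]
  exact pow_lambdaInvariant_le_natCard_quotient_augIdealP (finite_quotient_augIdealP_of_card_lt hab hlt)

end Lambda

/-! ## §6 The layer form: `Q'_n = M/(ω_n, p)M`, `ω_n = (1+T)^{pⁿ} − 1` -/

section Layers

variable {M : Type u} [AddCommGroup M] [Module (IwasawaAlgebra p) M] [Module.Finite (IwasawaAlgebra p) M]

omit [Module.Finite (IwasawaAlgebra p) M] in
/-- `(ω_n, p)M = (T^{pⁿ}, p)M`. [cite: Washington1997, §13.3 (proof of Lemma 13.18)] -/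
theorem omega_smul_top_eq (n : ℕ) :
    (Ideal.span {((1 + X) ^ p ^ n - 1 : IwasawaAlgebra p)} ⊔ augIdealP p) • (⊤ : Submodule (IwasawaAlgebra p) M) =
      (Ideal.span {(X : IwasawaAlgebra p) ^ p ^ n} ⊔ augIdealP p) • (⊤ : Submodule (IwasawaAlgebra p) M) := by
  rw [span_omega_sup_augIdealP_eq p n]

/-- **The rank-jump criterion in layer form, `μ`-part: `#Q'_k · p^{p^j} < #Q'_j · p^{p^k}` for ONE pair `j < k`
(`Q'_n = M/(ω_n, p)M`) forces `μ(M) = 0`.** For the Pontryagin dual `X` of a Selmer group over a `ℤ_p`-extension,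
`#Q'_n = #Sel_∞^{Γ_n}[p]`, so this is «`dim_{𝔽_p} Sel_∞^{Γ_k}[p] − dim_{𝔽_p} Sel_∞^{Γ_j}[p] < p^k − p^j ⟹ μ = 0`».
[cite: Washington1997, §13.3 Prop. 13.23] [cite: Fukuda1994, Thm. 1] -/
theorem muInvariant_eq_zero_of_card_layerQuotient_lt {j k : ℕ} (hjk : j < k)
    (hlt : Nat.card (M ⧸ (Ideal.span {((1 + X) ^ p ^ k - 1 : IwasawaAlgebra p)} ⊔ augIdealP p) •
          (⊤ : Submodule (IwasawaAlgebra p) M)) * p ^ (p ^ j) <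
      Nat.card (M ⧸ (Ideal.span {((1 + X) ^ p ^ j - 1 : IwasawaAlgebra p)} ⊔ augIdealP p) •
          (⊤ : Submodule (IwasawaAlgebra p) M)) * p ^ (p ^ k)) :
    muInvariant p M = 0 := by
  rw [omega_smul_top_eq, omega_smul_top_eq] at hlt
  exact muInvariant_eq_zero_of_card_lt (Nat.pow_lt_pow_right hp.out.one_lt hjk) hlt

/-- Layer form, torsion part: the rank jump at layers `j < k` forces `M` to be `Λ`-torsion. [cite: Washington1997, §13.3 Prop. 13.23] -/
theorem isTorsion_of_card_layerQuotient_lt {j k : ℕ} (hjk : j < k)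
    (hlt : Nat.card (M ⧸ (Ideal.span {((1 + X) ^ p ^ k - 1 : IwasawaAlgebra p)} ⊔ augIdealP p) •
          (⊤ : Submodule (IwasawaAlgebra p) M)) * p ^ (p ^ j) <
      Nat.card (M ⧸ (Ideal.span {((1 + X) ^ p ^ j - 1 : IwasawaAlgebra p)} ⊔ augIdealP p) •
          (⊤ : Submodule (IwasawaAlgebra p) M)) * p ^ (p ^ k)) :
    Module.IsTorsion (IwasawaAlgebra p) M := by
  rw [omega_smul_top_eq, omega_smul_top_eq] at hlt
  exact isTorsion_of_card_lt (Nat.pow_lt_pow_right hp.out.one_lt hjk) hlt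

/-- Layer form, `ℤ_p`-part: the rank jump at layers `j < k` forces `M` to be finitely generated over `ℤ_p`.
[cite: GreenbergLNM1716, §1 p. 60] [cite: Washington1997, §13.3 Prop. 13.23] -/
theorem moduleFinite_padicInt_of_card_layerQuotient_lt {j k : ℕ} (hjk : j < k)
    (hlt : Nat.card (M ⧸ (Ideal.span {((1 + X) ^ p ^ k - 1 : IwasawaAlgebra p)} ⊔ augIdealP p) •
          (⊤ : Submodule (IwasawaAlgebra p) M)) * p ^ (p ^ j) <
      Nat.card (M ⧸ (Ideal.span {((1 + X) ^ p ^ j - 1 : IwasawaAlgebra p)} ⊔ augIdealP p) •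
          (⊤ : Submodule (IwasawaAlgebra p) M)) * p ^ (p ^ k)) :
    Module.Finite ℤ_[p] (RestrictScalars ℤ_[p] (IwasawaAlgebra p) M) := by
  rw [omega_smul_top_eq, omega_smul_top_eq] at hlt
  exact moduleFinite_padicInt_of_card_lt (Nat.pow_lt_pow_right hp.out.one_lt hjk) hlt

/-- Layer form, `M/pM`: the rank jump at layers `j < k` forces `M/pM` finite with `#(M/pM) = #Q'_k`.
[cite: Washington1997, §13.3 Prop. 13.23] -/
theorem finite_quotient_augIdealP_and_natCard_eq_of_card_layerQuotient_lt {j k : ℕ} (hjk : j < k)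
    (hlt : Nat.card (M ⧸ (Ideal.span {((1 + X) ^ p ^ k - 1 : IwasawaAlgebra p)} ⊔ augIdealP p) •
          (⊤ : Submodule (IwasawaAlgebra p) M)) * p ^ (p ^ j) <
      Nat.card (M ⧸ (Ideal.span {((1 + X) ^ p ^ j - 1 : IwasawaAlgebra p)} ⊔ augIdealP p) •
          (⊤ : Submodule (IwasawaAlgebra p) M)) * p ^ (p ^ k)) :
    Finite (M ⧸ augIdealP p • (⊤ : Submodule (IwasawaAlgebra p) M)) ∧
      Nat.card (M ⧸ augIdealP p • (⊤ : Submodule (IwasawaAlgebra p) M)) =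
        Nat.card (M ⧸ (Ideal.span {((1 + X) ^ p ^ k - 1 : IwasawaAlgebra p)} ⊔ augIdealP p) •
          (⊤ : Submodule (IwasawaAlgebra p) M)) := by
  rw [omega_smul_top_eq, omega_smul_top_eq] at hlt
  rw [omega_smul_top_eq]
  exact ⟨finite_quotient_augIdealP_of_card_lt (Nat.pow_lt_pow_right hp.out.one_lt hjk) hlt,
    natCard_quotient_augIdealP_eq_of_card_lt (Nat.pow_lt_pow_right hp.out.one_lt hjk) hlt⟩

/-- **Layer form, `λ`-part: `p^{λ(M)} ≤ #Q'_k`** under the rank jump at layers `j < k` (for a Selmer dual: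
`λ ≤ dim_{𝔽_p} Sel_∞^{Γ_k}[p]`). [cite: Washington1997, §13.3 Prop. 13.23] [cite: Fukuda1994, Thm. 1 (2)] -/
theorem pow_lambdaInvariant_le_of_card_layerQuotient_lt {j k : ℕ} (hjk : j < k)
    (hlt : Nat.card (M ⧸ (Ideal.span {((1 + X) ^ p ^ k - 1 : IwasawaAlgebra p)} ⊔ augIdealP p) •
          (⊤ : Submodule (IwasawaAlgebra p) M)) * p ^ (p ^ j) <
      Nat.card (M ⧸ (Ideal.span {((1 + X) ^ p ^ j - 1 : IwasawaAlgebra p)} ⊔ augIdealP p) •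
          (⊤ : Submodule (IwasawaAlgebra p) M)) * p ^ (p ^ k)) :
    p ^ lambdaInvariant p M ≤
      Nat.card (M ⧸ (Ideal.span {((1 + X) ^ p ^ k - 1 : IwasawaAlgebra p)} ⊔ augIdealP p) •
          (⊤ : Submodule (IwasawaAlgebra p) M)) := by
  rw [omega_smul_top_eq, omega_smul_top_eq] at hlt
  rw [omega_smul_top_eq]
  exact pow_lambdaInvariant_le_of_card_lt (Nat.pow_lt_pow_right hp.out.one_lt hjk) hlt

end Layers

/-! ## §7 Converse: for `M/pM` finite (e.g. `μ(M) = 0`, `M` torsion) the door opens at some pair `a < b` -/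

section Converse

variable {M : Type u} [AddCommGroup M] [Module (IwasawaAlgebra p) M] [Module.Finite (IwasawaAlgebra p) M]

omit [Module.Finite (IwasawaAlgebra p) M] in
/-- If `M/pM` is finite then `(T^a, p)M = pM` for all large `a` (`T` acts nilpotently on the finite `Λ`-module `M/pM`).
[cite: Washington1997, §13.2 (Nakayama; `Λ`-modules of finite cardinality)] -/
theorem exists_forall_smul_top_eq_of_finite_quotient_augIdealP
    (hfin : Finite (M ⧸ augIdealP p • (⊤ : Submodule (IwasawaAlgebra p) M))) :
    ∃ n₀ : ℕ, ∀ a : ℕ, n₀ ≤ a →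
      (Ideal.span {(X : IwasawaAlgebra p) ^ a} ⊔ augIdealP p) • (⊤ : Submodule (IwasawaAlgebra p) M) = augIdealP p • ⊤ := by
  haveI := hfin
  obtain ⟨k, hk⟩ := exists_pow_X_smul_eq_zero_of_finite p (M ⧸ augIdealP p • (⊤ : Submodule (IwasawaAlgebra p) M))
  refine ⟨k, fun a hka ↦ ?_⟩
  rw [Submodule.sup_smul]
  refine sup_eq_right.mpr ?_
  rw [Submodule.smul_le]
  intro r hr n _
  obtain ⟨c, rfl⟩ := Ideal.mem_span_singleton'.mp hr
  obtain ⟨d, rfl⟩ := Nat.exists_eq_add_of_le hka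
  rw [mul_smul, pow_add, mul_smul]
  refine Submodule.smul_mem _ c ?_
  have h := hk (Submodule.Quotient.mk ((X : IwasawaAlgebra p) ^ d • n))
  rwa [← Submodule.Quotient.mk_smul, Submodule.Quotient.mk_eq_zero] at h

omit [Module.Finite (IwasawaAlgebra p) M] in
/-- **The door is complete**: if `M/pM` is finite there is a pair `a < b` with `#Q_b · p^a < #Q_a · p^b` (both quotients equal
`M/pM` for `a, b` large). [cite: Washington1997, §13.3 Prop. 13.23] -/
theorem exists_card_lt_of_finite_quotient_augIdealP
    (hfin : Finite (M ⧸ augIdealP p • (⊤ : Submodule (IwasawaAlgebra p) M))) :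
    ∃ a b : ℕ, a < b ∧
      Nat.card (M ⧸ (Ideal.span {(X : IwasawaAlgebra p) ^ b} ⊔ augIdealP p) • (⊤ : Submodule (IwasawaAlgebra p) M)) *
          p ^ a <
        Nat.card (M ⧸ (Ideal.span {(X : IwasawaAlgebra p) ^ a} ⊔ augIdealP p) • (⊤ : Submodule (IwasawaAlgebra p) M)) *
          p ^ b := by
  haveI := hfin
  obtain ⟨n₀, hn₀⟩ := exists_forall_smul_top_eq_of_finite_quotient_augIdealP hfin
  refine ⟨n₀, n₀ + 1, Nat.lt_succ_self n₀, ?_⟩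
  rw [hn₀ n₀ le_rfl, hn₀ (n₀ + 1) (Nat.le_succ n₀), pow_succ]
  have hpos : 0 < Nat.card (M ⧸ augIdealP p • (⊤ : Submodule (IwasawaAlgebra p) M)) := Nat.card_pos
  have hppos : 0 < p ^ n₀ := pow_pos hp.out.pos n₀
  have h1 : p ^ n₀ * 1 < p ^ n₀ * p := Nat.mul_lt_mul_of_pos_left hp.out.one_lt hppos
  rw [mul_one] at h1
  exact Nat.mul_lt_mul_of_pos_left h1 hpos

/-- **`μ(M) = 0` for a finitely generated torsion `Λ`-module `M` makes `M/pM` finite** (tree: `μ = 0 ⟺ M` finitely generated over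
`ℤ_p`; then `M/pM` is a finitely generated module over the finite field `ℤ_p/p`). [cite: Washington1997, §13.2] [cite: GreenbergLNM1716, §1 p. 60] -/
theorem finite_quotient_augIdealP_of_muInvariant_eq_zero (hM : Module.IsTorsion (IwasawaAlgebra p) M)
    (hμ : muInvariant p M = 0) : Finite (M ⧸ augIdealP p • (⊤ : Submodule (IwasawaAlgebra p) M)) := by
  letI : Module ℤ_[p] M := Module.compHom M (algebraMap ℤ_[p] (IwasawaAlgebra p))
  haveI : IsScalarTower ℤ_[p] (IwasawaAlgebra p) M := IsScalarTower.of_algebraMap_smul fun _ _ ↦ rfl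
  haveI hfg : Module.Finite ℤ_[p] M := (muInvariant_eq_zero_iff_holds p M hM).mp hμ
  haveI : Finite (ℤ_[p] ⧸ IsLocalRing.maximalIdeal ℤ_[p]) :=
    Finite.of_equiv _ (PadicInt.residueField (p := p)).toEquiv.symm
  -- `M/𝔪_{ℤ_p}M` is finite
  set P' : Submodule ℤ_[p] M := (IsLocalRing.maximalIdeal ℤ_[p]) • ⊤ with hP'
  haveI : Finite (M ⧸ P') := by
    refine Module.finite_of_finite_quotient_of_le_annihilator (R := ℤ_[p]) (IsLocalRing.maximalIdeal ℤ_[p]) ?_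
    intro r hr
    rw [Module.mem_annihilator]
    intro x
    induction x using Submodule.Quotient.induction_on with
    | H m =>
      rw [← Submodule.Quotient.mk_smul, Submodule.Quotient.mk_eq_zero]
      exact Submodule.smul_mem_smul hr Submodule.mem_top
  -- and it is `M/pM`
  have hsmul : ∀ m : M, (p : ℤ_[p]) • m = (C (p : ℤ_[p]) : IwasawaAlgebra p) • m := by
    intro m
    change (algebraMap ℤ_[p] (IwasawaAlgebra p) (p : ℤ_[p])) • m = _
    rw [PowerSeries.algebraMap_apply, Algebra.algebraMap_self_apply]
  have heq : P'.toAddSubgroup = (augIdealP p • (⊤ : Submodule (IwasawaAlgebra p) M)).toAddSubgroup := by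
    ext x
    rw [Submodule.mem_toAddSubgroup, Submodule.mem_toAddSubgroup, hP', PadicInt.maximalIdeal_eq_span_p,
      Submodule.ideal_span_singleton_smul, Submodule.mem_smul_pointwise_iff_exists]
    change _ ↔ x ∈ Ideal.span {(C (p : ℤ_[p]) : IwasawaAlgebra p)} • (⊤ : Submodule (IwasawaAlgebra p) M)
    rw [Submodule.ideal_span_singleton_smul, Submodule.mem_smul_pointwise_iff_exists]
    constructor
    · rintro ⟨m, -, rfl⟩
      exact ⟨m, Submodule.mem_top, (hsmul m).symm⟩
    · rintro ⟨m, -, rfl⟩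
      exact ⟨m, Submodule.mem_top, hsmul m⟩
  have hcard : Nat.card (M ⧸ P') = Nat.card (M ⧸ augIdealP p • (⊤ : Submodule (IwasawaAlgebra p) M)) :=
    congrArg (fun H : AddSubgroup M ↦ Nat.card (M ⧸ H)) heq
  exact Nat.finite_of_card_ne_zero (hcard ▸ Nat.card_pos.ne')

/-- **`μ = 0` ⟺ the rank-jump door opens at some pair `a < b`**, for a finitely generated torsion `Λ`-module.
[cite: Washington1997, §13.3 Prop. 13.23] [cite: Fukuda1994, Thm. 1] -/
theorem muInvariant_eq_zero_iff_exists_card_lt (hM : Module.IsTorsion (IwasawaAlgebra p) M) :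
    muInvariant p M = 0 ↔ ∃ a b : ℕ, a < b ∧
      Nat.card (M ⧸ (Ideal.span {(X : IwasawaAlgebra p) ^ b} ⊔ augIdealP p) • (⊤ : Submodule (IwasawaAlgebra p) M)) *
          p ^ a <
        Nat.card (M ⧸ (Ideal.span {(X : IwasawaAlgebra p) ^ a} ⊔ augIdealP p) • (⊤ : Submodule (IwasawaAlgebra p) M)) *
          p ^ b :=
  ⟨fun hμ ↦ exists_card_lt_of_finite_quotient_augIdealP (finite_quotient_augIdealP_of_muInvariant_eq_zero hM hμ),
    fun ⟨_, _, hab, hlt⟩ ↦ muInvariant_eq_zero_of_card_lt hab hlt⟩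

end Converse

end Literature.NumberTheory.IwasawaTheory.IwasawaModuleRankJump

end
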